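import Summits.BirchSwinnertonDyer.BirchSwinnertonDyer.Theorems.TwoAdicConverseOrdLambdaHalfAtTwoThetaDatumDefs
import Summits.BirchSwinnertonDyer.BirchSwinnertonDyer.Theorems.TwoAdicConverseOrdLambdaHalfAtTwoShapiroDatumKernel
import Summits.BirchSwinnertonDyer.BirchSwinnertonDyer.Theorems.TwoAdicConverseOrdLambdaHalfAtTwoKatoCoreMinusSide
import HarnessLib

/-!
# Route `TwoAdicConverse` (rung S3), crux `OrdLambdaHalfAtTwo` (item stmt-BirchSwinnertonDyer-19556), line
# `kato-determinant-greenberg-two`, skeleton v4.5: KERNEL theorems for the re-keyed datum `ThetaShapiroKatoGreenbergDatum` —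
# `λ` is blind to the keying automorphism `θ`, `λ`-Poitou–Tate, hPT, transparency, and «nothing of v4.3 is lost»

Seat `cruxlead-stmt-BirchSwinnertonDyer-19556-g3` (LEAD PROVER, MODE LINE; `--supports` stmt-BirchSwinnertonDyer-19556, helper).  HONEST FRAMING
(cell bsd-2adic): BSD is not proved by any of this; the crux is NOT proved here; THEOREMS ONLY (no definition, no named fact, no instance, no `sorry`).
Sequel of `…ThetaDatumDefs` (triage r1-1 GEN 19 Δ19-2, repair R-b: the Poitou–Tate map `δ : 𝐇¹_loc ⧸ L → X_Gr` is `θ`-SEMILINEAR for a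
constant-fixing automorphism `θ` of `Λ`).  Content, verbatim the v4.3 kernel (`…ShapiroDatumKernel`, p679569) re-proved for the re-keyed datum:

* `lambdaInvariant_eq_of_semilinear_bijective` — a bijective `θ`-semilinear map with `θ (C c) = C c` preserves `λ` (the argument of
  `IwasawaAlgebra.lambdaInvariant_eq_of_involSemilinear` for a general `θ`: `ℤ_p`-linear on the underlying modules, base change to `ℚ_p`).
* `ThetaShapiroKatoGreenbergDatum.lambdaInvariant_quotient_range_eq_quotient_L` (the bridge, `L ⧸ range` killed by `2`), `lambdaInvariant_ker_eq`
  (`λ(ker π) = λ(𝐇¹_loc ⧸ L)` through `δ`), `lambda_PT` (`λ(X_Gr) = λ(𝐇¹_loc ⧸ range) + λ(X_fine)`), hPT `lambda_add_eq` / `gD_add_eq`, the TRANSPARENCY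
  theorem `gD_le_lambda_iff` (6‴ ⟺ `λ L₀ + λ L₀' ≤ b + b'`, datum by datum — unchanged), `gD_le_lambda_iff_eq_and_eq`, `lam_le_of_gD_le_lambda`, the
  `±`-decomposition and `gD_le_lambda_iff_plusSide` (through the core, p679854).
* `thetaSupply_of_shapiroSupply` / `shapiroDivisibility_of_thetaDivisibility` — the v4.3 ∃-supply implies the v4.5 one; the v4.5 ∀-divisibility implies
  the v4.3 one (`ShapiroKatoGreenbergDatum.toTheta`, `θ = refl`): the re-keying WEAKENS the supply hypothesis and loses nothing.

References: [Kato2004Asterisque] §17.13; [GreenbergLNM1716] §1 p. 60; [GreenbergVatsal2000] §2; [Washington1997] §13.2; triage r1-1 GEN 19 Δ19-2.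
-/

set_option linter.dupNamespace false
set_option autoImplicit false

noncomputable section

open scoped Classical NumberField
open WeierstrassCurve NumberField IsDedekindDomain Field CategoryTheory Function
open Literature.NumberTheory.EllipticCurves Literature.NumberTheory.EllipticCurves.Rank1Residual
open Literature.NumberTheory.EllipticCurves.Kato2004 Literature.NumberTheory.EllipticCurves.Kato2004.EulerSystemValues
open Literature.NumberTheory.GaloisRepresentations
open Summit.BirchSwinnertonDyer.Rank1Residual.X1.MuLambda (lam)
open Summit.BirchSwinnertonDyer.Rank1Residual.X11b (AcSelmer.bdpData AcSelmer.strictDatum)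

namespace Summit.BirchSwinnertonDyer.BirchSwinnertonDyer.Theorems.TwoAdicKatoDeterminant

/-! ## §1 `λ` is blind to the keying; `λ`-Poitou–Tate; hPT; transparency -/

section ThetaKernel

variable {W : WeierstrassCurve ℚ} [W.IsElliptic] [ContinuousSMul ℤ_[2] (W.tateModule 2)]
  {A : WeierstrassCurve ℚ} [A.IsElliptic] [ContinuousSMul ℤ_[2] (A.tateModule 2)]
  {κ : ZpExtension ℚ 2} {γ : absoluteGaloisGroup ℚ}
  {I_W : IwasawaH1Data W 2 κ γ} {I_A : IwasawaH1Data A 2 κ γ}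
  {v : HeightOneSpectrum (𝓞 ℚ)} {γᵥ : absoluteGaloisGroup (v.adicCompletion ℚ)}
  {J : LocalIwasawaH1Data κ v ((tateRep W 2).toLocal v) γᵥ}
  {J' : LocalIwasawaH1Data κ v (tateLocalOrdinaryRep W 2 v) γᵥ}
  {J_A : LocalIwasawaH1Data κ v ((tateRep A 2).toLocal v) γᵥ}
  {uA : ((tateRep A 2).toLocal v).toTopRep ⟶ ((tateRep W 2).toLocal v).toTopRep}
  {hsurj : Function.Surjective
    (κ.toContinuousMonoidHom.comp (resGalOfEmb (closureEmb (K := ℚ) (v.adicCompletion ℚ))))}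
  {hγ : κ.IsTopGenerator γ}
  {hγᵥ : κ.IsTopGenerator (resGalOfEmb (closureEmb (K := ℚ) (v.adicCompletion ℚ)) γᵥ)}
  {K : Type} [Field K] [NumberField K] {κK : ZpExtension K 2} {γK : absoluteGaloisGroup K}
  {w : HeightOneSpectrum (𝓞 K)}
  {DGr : (W.baseChange K).GreenbergStrictSelmerDualData κK γK (AcSelmer.bdpData (MK W K) 2 w)}
  {Dfi : (W.baseChange K).GreenbergStrictSelmerDualData κK γK (fineData W K)}
  {L₀ L₀' : IwasawaAlgebra 2} {b b' : ℕ}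

/-- **`λ` is blind to constant-fixing re-keyings**: a bijective `θ`-semilinear map between `Λ`-modules, `θ` a ring endomorphism of `Λ = ℤ_p⟦T⟧`
fixing the constants, preserves `lambdaInvariant` (it is `ℤ_p`-linear on the underlying `ℤ_p`-modules and base-changes to a `ℚ_p`-linear
equivalence) — the argument of `IwasawaAlgebra.lambdaInvariant_eq_of_involSemilinear` for a general `θ`. [cite: Washington1997, §13.2]
[cite: GreenbergLNM1716, §1 p. 60 (the two Λ-structures on a dual)] -/
theorem lambdaInvariant_eq_of_semilinear_bijective {p : ℕ} [Fact p.Prime]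
    {M : Type*} [AddCommGroup M] [Module (IwasawaAlgebra p) M] {N : Type*} [AddCommGroup N] [Module (IwasawaAlgebra p) N]
    {θ : IwasawaAlgebra p →+* IwasawaAlgebra p} (hθ : ∀ c : ℤ_[p], θ (PowerSeries.C c) = PowerSeries.C c)
    (f : M →ₛₗ[θ] N) (hf : Function.Bijective f) :
    lambdaInvariant p M = lambdaInvariant p N := by
  let e : M ≃+ N := AddEquiv.ofBijective f.toAddMonoidHom hf
  have he : ∀ (a : IwasawaAlgebra p) (m : M), e (a • m) = θ a • e m := fun a m ↦ f.map_smulₛₗ a m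
  let e' : RestrictScalars ℤ_[p] (IwasawaAlgebra p) M ≃ₗ[ℤ_[p]]
      RestrictScalars ℤ_[p] (IwasawaAlgebra p) N :=
    { ((RestrictScalars.addEquiv ℤ_[p] (IwasawaAlgebra p) M).trans e).trans
        (RestrictScalars.addEquiv ℤ_[p] (IwasawaAlgebra p) N).symm with
      map_smul' := fun a x ↦ by
        change e (algebraMap ℤ_[p] (IwasawaAlgebra p) a • (RestrictScalars.addEquiv ℤ_[p] (IwasawaAlgebra p) M x)) =
          algebraMap ℤ_[p] (IwasawaAlgebra p) a • e (RestrictScalars.addEquiv ℤ_[p] (IwasawaAlgebra p) M x)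
        rw [he, PowerSeries.algebraMap_eq, hθ] }
  unfold lambdaInvariant
  exact (e'.baseChange ℤ_[p] ℚ_[p] _ _).finrank_eq

namespace ThetaShapiroKatoGreenbergDatum

variable (Sθ : ThetaShapiroKatoGreenbergDatum I_W I_A J J' J_A uA hsurj hγ hγᵥ DGr Dfi L₀ L₀' b b')

/-- **The bridge**: `λ(𝐇¹_loc ⧸ range) = λ(𝐇¹_loc ⧸ L)` — the Shapiro defect `L ⧸ range` is killed by `2`, hence `λ`-invisible (as for v4.3).
[cite: Washington1997, §13.2] -/
theorem lambdaInvariant_quotient_range_eq_quotient_L :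
    lambdaInvariant 2 (J.H ⧸ LinearMap.range ((I_W.loc J hsurj hγ hγᵥ).coprod (J_A.map uA J ∘ₗ I_A.loc J_A hsurj hγ hγᵥ))) =
      lambdaInvariant 2 (J.H ⧸ Sθ.L) := by
  haveI := Sθ.finiteHl
  refine lambdaInvariant_quotient_eq_of_forall_exists_C_pow_smul_mem 2 _ _ Sθ.range_le (fun y hy ↦ ⟨1, ?_⟩)
    Sθ.toPinnedKatoCore.isTorsion_quotient_range
  rw [pow_one, map_natCast, Nat.cast_ofNat]
  exact Sθ.two_smul_mem y hy

/-- **`λ(ker π) = λ(𝐇¹_loc ⧸ L)`**: the `θ`-semilinear injection `δ` maps `𝐇¹_loc ⧸ L` ONTO `ker π` (exactness), a bijective `θ`-semilinear map, and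
`λ` is `θ`-blind (`θ_C`). [cite: GreenbergLNM1716, §1 p. 60] [cite: Washington1997, §13.2] -/
theorem lambdaInvariant_ker_eq : lambdaInvariant 2 (LinearMap.ker Sθ.π) = lambdaInvariant 2 (J.H ⧸ Sθ.L) := by
  -- `δ` co-restricted to `ker π`, still `θ`-semilinear
  have hmem : ∀ x, Sθ.δ x ∈ LinearMap.ker Sθ.π := fun x ↦ by
    rw [LinearMap.mem_ker]
    exact (Sθ.exact_δ_π (Sθ.δ x)).mpr ⟨x, rfl⟩
  let δ' : (J.H ⧸ Sθ.L) →ₛₗ[(Sθ.θ : IwasawaAlgebra 2 →+* IwasawaAlgebra 2)] LinearMap.ker Sθ.π :=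
    { toFun := fun x ↦ ⟨Sθ.δ x, hmem x⟩
      map_add' := fun x y ↦ Subtype.ext (Sθ.δ.map_add x y)
      map_smul' := fun a x ↦ Subtype.ext (Sθ.δ.map_smulₛₗ a x) }
  have hbij : Function.Bijective δ' := by
    refine ⟨fun x y h ↦ Sθ.δ_injective (congrArg Subtype.val h), fun ⟨z, hz⟩ ↦ ?_⟩
    obtain ⟨x, hx⟩ := (Sθ.exact_δ_π z).mp (LinearMap.mem_ker.mp hz)
    exact ⟨x, Subtype.ext hx⟩
  exact (lambdaInvariant_eq_of_semilinear_bijective Sθ.θ_C δ' hbij).symm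

/-- **`λ`-Poitou–Tate for the re-keyed datum, Shapiro form**: with `X_Gr` finitely generated torsion, `λ(X_Gr) = λ(𝐇¹_loc ⧸ L) + λ(X_fine)`
(`λ`-additivity along `ker π ↪ X_Gr ↠ X_fine` and `λ(ker π) = λ(𝐇¹_loc ⧸ L)`); the `range` form follows by the bridge. [cite: GreenbergVatsal2000, §2]
[cite: Washington1997, §13.2] -/
theorem lambda_PT (h : Module.Finite (IwasawaAlgebra 2) DGr.X ∧ Module.IsTorsion (IwasawaAlgebra 2) DGr.X) :
    lambdaInvariant 2 DGr.X = lambdaInvariant 2 (J.H ⧸ Sθ.L) + lambdaInvariant 2 Dfi.X := by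
  haveI := h.1
  rw [← Sθ.lambdaInvariant_ker_eq]
  exact Summit.BirchSwinnertonDyer.Rank1Residual.X2.DualRestrictionInvariants.lambdaInvariant_eq_add_of_surjective 2 Sθ.π h.2 Sθ.π_surjective

/-- **hPT — Poitou–Tate counted two ways** for the re-keyed datum: `λ(X_Gr) + (λ L₀ + λ L₀') = gD + (b + b')`.
[cite: Kato2004Asterisque, §17.13] [cite: GreenbergVatsal2000, §2] -/
theorem lambda_add_eq (h : Module.Finite (IwasawaAlgebra 2) DGr.X ∧ Module.IsTorsion (IwasawaAlgebra 2) DGr.X) :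
    lambdaInvariant 2 DGr.X + (lam L₀ + lam L₀') = Sθ.gD + (b + b') := by
  haveI := Sθ.finiteHl
  exact lambda_twoWays_of_lambdaPT 2 (I_W.loc J hsurj hγ hγᵥ) (J_A.map uA J ∘ₗ I_A.loc J_A hsurj hγ hγᵥ)
    (Submodule.span (IwasawaAlgebra 2) {Sθ.zW}) (Submodule.span (IwasawaAlgebra 2) {Sθ.zA}) Sθ.loc_injective
    Sθ.isTorsion_quot (by rw [Sθ.lambdaInvariant_quotient_range_eq_quotient_L]; exact Sθ.lambda_PT h) Sθ.katoIndex

/-- `gD + (b + b') = λ(X_Gr) + (λ L₀ + λ L₀')`. [cite: Kato2004Asterisque, §17.13] -/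
theorem gD_add_eq (h : Module.Finite (IwasawaAlgebra 2) DGr.X ∧ Module.IsTorsion (IwasawaAlgebra 2) DGr.X) :
    Sθ.gD + (b + b') = lambdaInvariant 2 DGr.X + (lam L₀ + lam L₀') :=
  (Sθ.lambda_add_eq h).symm

/-- **Transparency (unchanged by the re-keying)**: `gD ≤ λ(X_Gr) ↔ λ L₀ + λ L₀' ≤ b + b'` — stub 6‴ is, datum by datum, the summed
`λ`-inequality. [cite: GreenbergVatsal2000, §2] -/
theorem gD_le_lambda_iff (h : Module.Finite (IwasawaAlgebra 2) DGr.X ∧ Module.IsTorsion (IwasawaAlgebra 2) DGr.X) :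
    Sθ.gD ≤ lambdaInvariant 2 DGr.X ↔ lam L₀ + lam L₀' ≤ b + b' := by
  have := Sθ.lambda_add_eq h
  omega

/-- Under Kato's two inequalities, stub 6‴ IS the `λ`-main-conjecture pair `λ L₀ = b ∧ λ L₀' = b'`. [cite: Kato2004Asterisque, Thm 17.4] -/
theorem gD_le_lambda_iff_eq_and_eq (h : Module.Finite (IwasawaAlgebra 2) DGr.X ∧ Module.IsTorsion (IwasawaAlgebra 2) DGr.X)
    (hb : b ≤ lam L₀) (hb' : b' ≤ lam L₀') :
    Sθ.gD ≤ lambdaInvariant 2 DGr.X ↔ lam L₀ = b ∧ lam L₀' = b' := by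
  rw [Sθ.gD_le_lambda_iff h]
  omega

/-- How the skeleton's `omega` spine consumes 6‴: `gD ≤ λ(X_Gr)` and `b' ≤ λ L₀'` give `λ L₀ ≤ b`. [cite: Kato2004Asterisque, Thm 17.4] -/
theorem lam_le_of_gD_le_lambda (h : Module.Finite (IwasawaAlgebra 2) DGr.X ∧ Module.IsTorsion (IwasawaAlgebra 2) DGr.X)
    (hGr : Sθ.gD ≤ lambdaInvariant 2 DGr.X) (hb' : b' ≤ lam L₀') : lam L₀ ≤ b := by
  have := (Sθ.gD_le_lambda_iff h).mp hGr
  omega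

/-- The `±`-decomposition for a re-keyed datum (through its core). [cite: Kato2004Asterisque, §17.13 (shape only)] -/
theorem gD_eq_lambda_plus_add_lambda_minus :
    Sθ.gD = lambdaInvariant 2 (↥(localOrdinaryPart J' J) ⧸ (Sθ.toPinnedKatoCore.zetaSpan).comap (localOrdinaryPart J' J).subtype) +
      lambdaInvariant 2 (J.H ⧸ (localOrdinaryPart J' J ⊔ Sθ.toPinnedKatoCore.zetaSpan)) :=
  Sθ.toPinnedKatoCore.gD_eq_lambda_plus_add_lambda_minus

/-- **Stub 6‴ datum by datum after the kernel minus side**: for `L₀ ≠ 0`, `gD ≤ λ(X_Gr)` iff `λ(H_f ⧸ (H_f ⊓ Sθ)) + λ(Λ ⧸ (L₀, L₀')) ≤ λ(X_Gr)`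
(the core's `gD = λ⁺ + λ(Λ ⧸ (L₀, L₀'))`, `PinnedKatoCore.gD_eq_lambda_plusSide_add`). [cite: Kato2004Asterisque, §17.13 (17.13.1)–(17.13.3)] -/
theorem gD_le_lambda_iff_plusSide (hL₀ : L₀ ≠ 0) :
    Sθ.gD ≤ lambdaInvariant 2 DGr.X ↔
      lambdaInvariant 2 (↥(localOrdinaryPart J' J) ⧸ (Sθ.toPinnedKatoCore.zetaSpan).comap (localOrdinaryPart J' J).subtype) +
        lambdaInvariant 2 (IwasawaAlgebra 2 ⧸ (Ideal.span {L₀} ⊔ Ideal.span {L₀'})) ≤ lambdaInvariant 2 DGr.X := by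
  rw [show Sθ.gD = Sθ.toPinnedKatoCore.gD from rfl, Sθ.toPinnedKatoCore.gD_eq_lambda_plusSide_add hL₀]

end ThetaShapiroKatoGreenbergDatum

/-! ### Nothing of v4.3 is lost: the v4.3 binders versus the v4.5 binders -/

/-- The v4.3 ∃-supply (mis-keyed: stronger, in all likelihood unsuppliable for general `κK`) IMPLIES the v4.5 ∃-supply (`toTheta`, `θ := refl`).
[cite: Kato2004Asterisque, §17.13 (shape only)] -/
theorem thetaSupply_of_shapiroSupply (h : ShapiroKatoGreenbergSupplyAtTwo) : ThetaShapiroKatoGreenbergSupplyAtTwo := by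
  intro W _ _ hCM hGO hβ κ γ hκ hγ hγ' hord _ f hf D L₀ hL₀ K _ _ hK A _ _ C hA hordA _ g hg DA L₀' hL₀' w hw κK γK hκK hγK
    DGr Dfi hcot _ _
  obtain ⟨v, γᵥ, hsurj, hγᵥ, I_W, I_A, J, J', J_A, uA, ⟨P⟩⟩ := h W hCM hGO hβ κ γ hκ hγ hγ' hord f hf D L₀ hL₀ K hK A C hA
    hordA g hg DA L₀' hL₀' w hw κK γK hκK hγK DGr Dfi hcot
  exact ⟨v, γᵥ, hsurj, hγᵥ, I_W, I_A, J, J', J_A, uA, ⟨P.toTheta⟩⟩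

/-- The v4.5 ∀-divisibility IMPLIES the v4.3 ∀-divisibility (every v4.3 datum is a v4.5 datum with the same `gD`).
[cite: Kato2004Asterisque, §17.13 (shape only)] -/
theorem shapiroDivisibility_of_thetaDivisibility (h : ThetaShapiroGreenbergDivisibilityAtTwo) :
    ShapiroGreenbergDivisibilityAtTwo := by
  intro W _ _ hCM hGO hβ κ γ hκ hγ hγ' hord _ f hf D L₀ hL₀ K _ _ hK A _ _ C hA hordA _ g hg DA L₀' hL₀' w hw κK γK hκK hγK
    DGr Dfi hcot _ _ v γᵥ hsurj hγᵥ I_W I_A J J' J_A uA P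
  rw [← P.toTheta_gD]
  exact h W hCM hGO hβ κ γ hκ hγ hγ' hord f hf D L₀ hL₀ K hK A C hA hordA g hg DA L₀' hL₀' w hw κK γK hκK hγK DGr Dfi hcot
    v γᵥ hsurj hγᵥ I_W I_A J J' J_A uA P.toTheta

end ThetaKernel

end Summit.BirchSwinnertonDyer.BirchSwinnertonDyer.Theorems.TwoAdicKatoDeterminant

end
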